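import Literature.AlgebraicGeometry.Limits.LocalizationIsoSpread
import HarnessLib

/-!
# Limits of schemes: a morphism which is an isomorphism over `Spec A_S` is an isomorphism over some `D(s)`

Topic: `Literature/AlgebraicGeometry/Limits`; companion of `LocalizationIsoSpread` (there: two
`A`-schemes ISOMORPHIC over `Spec A_S` are isomorphic over some `D(s)`; here: a GIVEN morphism which
becomes an isomorphism over `Spec A_S` is itself an isomorphism over some `D(s)` — EGA IV₃ 8.8.2.4 ∕
8.10.5 (i), Görtz–Wedhorn I Cor. 10.64 for the cofiltered system of basic opens `D(s)`, `s ∈ S`).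
Theorems only. Written by the prover seat `hodge-nonav-prover-Bx` (g18, cell `hodge-nonav`) as brick
**QF-3 «ISO-SPREAD»** of the programme «Q-FAMILY» (memo `PROGRAMME-Q-FAMILY-Bx-g18.md`; there it spreads
the isomorphism locus of a resolution of the generic member of a family), route-agnostic.

* `LocApprox.exists_isIso_overStage_of_isIso` — STAGE FORM: `P₁, P₂ → Spec A` quasi-compact,
  quasi-separated, locally of finite presentation; `g : P₁ ⊗ Spec A[1/s] → P₂` an `A`-morphism from a
  stage whose value at the limit, the `Spec B`-morphism `θ : P₁ ⊗ Spec B → P₂ ⊗ Spec B` with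
  `θ ≫ fst = (P₁ ◁ π_s) ≫ g`, is an isomorphism. Then over some finer stage `t → s` the
  `D(t)`-morphism `overStage (resStage h g) : P₁ ⊗ Spec A[1/t] → P₂ ⊗ Spec A[1/t]` is an isomorphism.
* `LocApprox.exists_isIso_whiskerRight_of_isIso` — GLOBAL FORM: for `f : P₁ → P₂` over `A` with
  `f ▷ Spec B` an isomorphism, `f ▷ Spec A[1/t]` is an isomorphism for some `t ∈ S`.

Proof = that of `exists_iso_of_iso_tensor_specOver`, with the spread of `θ.hom` replaced by the given
`g`: spread `θ.inv ≫ fst` to `β` over a common stage (`exists_whiskerLeft_comp_eq`); both composites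
of `overStage g`, `overStage β` restrict to identities at the limit, hence over finer stages
(`exists_whiskerLeft_map_comp_eq`), where they are mutually inverse (the transition maps are monic).
With `A` a domain and `A_S = Frac A`: a morphism of finitely presented `A`-schemes whose generic fibre
is an isomorphism is an isomorphism over a dense open subset of `Spec A`.

## References

* [GortzWedhorn2020] U. Görtz, T. Wedhorn, Algebraic Geometry I, 2nd ed. (2020), Thm. 10.63,
  Cor. 10.64, p. 329.
* [EGAIV3] A. Grothendieck, J. Dieudonné, EGA IV₃ (1966), Thm. 8.8.2, 8.8.2.4, Thm. 8.10.5 (i).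
-/

noncomputable section

universe u

open CategoryTheory CategoryTheory.Limits AlgebraicGeometry TopologicalSpace MonoidalCategory
  CartesianMonoidalCategory
open Opposite

namespace Literature.AlgebraicGeometry.Limits

namespace LocApprox

open Literature.AlgebraicGeometry.Motives (SchemeOver specOver)

set_option backward.isDefEq.respectTransparency false

variable {A : Type u} [CommRing A] {S : Submonoid A} {B : Type u} [CommRing B] [Algebra A B]
  [IsLocalization S B]
section Stage

variable {P₁ P₂ : SchemeOver A}

/-- For an `A`-morphism `f : P₁ → P₂`, `overStage (fst ≫ f) = f ▷ Spec A[1/t]`: the `D(t)`-morphism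
attached to `f` read on a stage is the base change of `f`. [folklore] -/
private theorem overStage_fst_comp (f : P₁ ⟶ P₂) (t : Idx S) :
    overStage (fst P₁ ((baseDiagram S).obj t) ≫ f) = f ▷ (baseDiagram S).obj t := by
  apply CartesianMonoidalCategory.hom_ext
  · rw [overStage_fst, whiskerRight_fst]
  · rw [overStage_snd, whiskerRight_snd]

/-- `resStage h (fst ≫ f) = fst ≫ f` (an `A`-morphism read on stages is compatible with restriction).
[folklore] -/
private theorem resStage_fst_comp (f : P₁ ⟶ P₂) {t s : Idx S} (h : t ⟶ s) :
    resStage h (fst P₁ ((baseDiagram S).obj s) ≫ f) = fst P₁ ((baseDiagram S).obj t) ≫ f := by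
  change (P₁ ◁ (baseDiagram S).map h) ≫ fst P₁ ((baseDiagram S).obj s) ≫ f = _
  rw [whiskerLeft_fst_assoc]

end Stage

variable {P₁ P₂ : SchemeOver A} [QuasiCompact P₁.hom]
  [LocallyOfFinitePresentation P₁.hom] [QuasiCompact P₂.hom] [QuasiSeparated P₂.hom]
  [LocallyOfFinitePresentation P₂.hom]

variable (S B) in
/-- **A morphism over a stage whose value at the limit is an isomorphism is an isomorphism over a
finer stage** (EGA IV₃ 8.8.2.4; Görtz–Wedhorn I Cor. 10.64, for `Spec A_S = lim_s Spec A[1/s]`). For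
`P₁, P₂ → Spec A` quasi-compact and locally of finite presentation (`P₂` quasi-separated), an `A`-morphism
`g : P₁ ⊗ Spec A[1/s] → P₂`, and an isomorphism `θ : P₁ ⊗ Spec B ≅ P₂ ⊗ Spec B` over `Spec B` with
`θ.hom ≫ fst = (P₁ ◁ π_s) ≫ g` (i.e. `θ` IS `g` at the limit), there is a stage `h : t → s` over
which the `D(t)`-morphism `overStage (resStage h g)` is an isomorphism.
[cite: GortzWedhorn2020, Cor. 10.64 (2), p. 329] [cite: EGAIV3, Thm. 8.8.2] -/
theorem exists_isIso_overStage_of_isIso {s : Idx S} (g : P₁ ⊗ (baseDiagram S).obj s ⟶ P₂)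
    (θ : P₁ ⊗ specOver A B ≅ P₂ ⊗ specOver A B) (hθ : θ.hom ≫ snd _ _ = snd _ _)
    (hg : (P₁ ◁ (baseCone S B).π.app s) ≫ g = θ.hom ≫ fst _ _) :
    ∃ (t : Idx S) (h : t ⟶ s), IsIso (overStage (resStage h g)) := by
  have hθ' : θ.inv ≫ snd _ _ = snd _ _ := by
    rw [Iso.inv_comp_eq, hθ]
  -- notation for the cone
  let π : ∀ s : Idx S, specOver A B ⟶ (baseDiagram S).obj s := fun s => (baseCone S B).π.app s
  have hπ : ∀ {t s : Idx S} (h : t ⟶ s), π t ≫ (baseDiagram S).map h = π s := fun h =>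
    ((baseCone S B).w h)
  -- spread out `θ.inv ≫ fst`
  obtain ⟨s₂, β₂, hβ₂⟩ :=
    exists_whiskerLeft_comp_eq (S := S) B (P := P₂) (X := P₁) (θ.inv ≫ fst _ _)
  -- common refinement `s'` of `s` and `s₂`
  obtain ⟨s', ⟨h₁⟩, ⟨h₂⟩⟩ := exists_hom₂ S s s₂
  let α : P₁ ⊗ (baseDiagram S).obj s' ⟶ P₂ := resStage h₁ g
  let β : P₂ ⊗ (baseDiagram S).obj s' ⟶ P₁ := resStage h₂ β₂
  have hα : (P₁ ◁ π s') ≫ α = θ.hom ≫ fst _ _ := by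
    change (P₁ ◁ π s') ≫ (P₁ ◁ (baseDiagram S).map h₁) ≫ g = _
    rw [← MonoidalCategory.whiskerLeft_comp_assoc, hπ h₁]
    exact hg
  have hβ : (P₂ ◁ π s') ≫ β = θ.inv ≫ fst _ _ := by
    change (P₂ ◁ π s') ≫ (P₂ ◁ (baseDiagram S).map h₂) ≫ β₂ = _
    rw [← MonoidalCategory.whiskerLeft_comp_assoc, hπ h₂]
    exact hβ₂
  have kα : (P₁ ◁ π s') ≫ overStage α = θ.hom ≫ (P₂ ◁ π s') :=
    whiskerLeft_π_overStage B α θ.hom hθ hα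
  have kβ : (P₂ ◁ π s') ≫ overStage β = θ.inv ≫ (P₁ ◁ π s') :=
    whiskerLeft_π_overStage B β θ.inv hθ' hβ
  -- the two composites are the identity at the limit, hence over finer stages `t₁`, `t₂`
  obtain ⟨t₁, k₁, e₁⟩ := exists_whiskerLeft_map_comp_eq (S := S) B (P := P₁)
    (X := P₁ ⊗ (baseDiagram S).obj s') (overStage α ≫ overStage β) (𝟙 _) (by
      rw [reassoc_of% kα, kβ, Iso.hom_inv_id_assoc, Category.comp_id])
  obtain ⟨t₂, k₂, e₂⟩ := exists_whiskerLeft_map_comp_eq (S := S) B (P := P₂)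
    (X := P₂ ⊗ (baseDiagram S).obj s') (overStage β ≫ overStage α) (𝟙 _) (by
      rw [reassoc_of% kβ, kα, Iso.inv_hom_id_assoc, Category.comp_id])
  -- common refinement `t`
  obtain ⟨t, ⟨l₁⟩, ⟨l₂⟩⟩ := exists_hom₂ S t₁ t₂
  have hk : l₁ ≫ k₁ = l₂ ≫ k₂ := Subsingleton.elim _ _
  let αt := overStage (resStage (l₁ ≫ k₁) α)
  let βt := overStage (resStage (l₁ ≫ k₁) β)
  have hαt : αt ≫ (P₂ ◁ (baseDiagram S).map (l₁ ≫ k₁)) =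
      (P₁ ◁ (baseDiagram S).map (l₁ ≫ k₁)) ≫ overStage α :=
    overStage_resStage_whiskerLeft _ _
  have hβt : βt ≫ (P₁ ◁ (baseDiagram S).map (l₁ ≫ k₁)) =
      (P₂ ◁ (baseDiagram S).map (l₁ ≫ k₁)) ≫ overStage β :=
    overStage_resStage_whiskerLeft _ _
  have e₁' : (P₁ ◁ (baseDiagram S).map (l₁ ≫ k₁)) ≫ overStage α ≫ overStage β =
      P₁ ◁ (baseDiagram S).map (l₁ ≫ k₁) := by
    rw [Functor.map_comp, MonoidalCategory.whiskerLeft_comp, Category.assoc, e₁, Category.comp_id]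
  have e₂' : (P₂ ◁ (baseDiagram S).map (l₁ ≫ k₁)) ≫ overStage β ≫ overStage α =
      P₂ ◁ (baseDiagram S).map (l₁ ≫ k₁) := by
    rw [hk, Functor.map_comp, MonoidalCategory.whiskerLeft_comp, Category.assoc, e₂,
      Category.comp_id]
  -- `αt` is `overStage (resStage ((l₁ ≫ k₁) ≫ h₁) g)`, with inverse `βt`
  have hres : resStage (l₁ ≫ k₁) α = resStage ((l₁ ≫ k₁) ≫ h₁) g := by
    change (P₁ ◁ (baseDiagram S).map (l₁ ≫ k₁)) ≫ (P₁ ◁ (baseDiagram S).map h₁) ≫ g = _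
    rw [← MonoidalCategory.whiskerLeft_comp_assoc, ← Functor.map_comp]
    rfl
  refine ⟨t, (l₁ ≫ k₁) ≫ h₁, ?_⟩
  rw [← hres]
  refine ⟨βt, ?_, ?_⟩
  · rw [← cancel_mono (P₁ ◁ (baseDiagram S).map (l₁ ≫ k₁)), Category.assoc, hβt,
      reassoc_of% hαt, e₁', Category.id_comp]
  · rw [← cancel_mono (P₂ ◁ (baseDiagram S).map (l₁ ≫ k₁)), Category.assoc, hαt,
      reassoc_of% hβt, e₂', Category.id_comp]

variable (S B) in
/-- **A morphism of finitely presented `A`-schemes which is an isomorphism over `Spec A_S` is an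
isomorphism over some `D(t)`, `t ∈ S`** (EGA IV₃ 8.10.5 (i); Görtz–Wedhorn I Cor. 10.64): for
`f : P₁ → P₂` over `A` (`P₁, P₂` quasi-compact and locally of finite presentation over `A`, `P₂`
quasi-separated) with `f ▷ Spec B` an isomorphism, `f ▷ Spec A[1/t]` is an isomorphism for some `t ∈ S`. With `A` a
domain and `B = Frac A`: an isomorphism of generic fibres comes from an isomorphism over a dense open.
[cite: EGAIV3, Thm. 8.10.5 (i)] [cite: GortzWedhorn2020, Cor. 10.64 (2), p. 329] -/
theorem exists_isIso_whiskerRight_of_isIso (f : P₁ ⟶ P₂) [IsIso (f ▷ specOver A B)] :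
    ∃ t : Idx S, IsIso (f ▷ (baseDiagram S).obj t) := by
  classical
  let s : Idx S := default
  let θ : P₁ ⊗ specOver A B ≅ P₂ ⊗ specOver A B := asIso (f ▷ specOver A B)
  have hθ : θ.hom ≫ snd _ _ = snd _ _ := whiskerRight_snd f _
  have hg : (P₁ ◁ (baseCone S B).π.app s) ≫ (fst P₁ ((baseDiagram S).obj s) ≫ f) = θ.hom ≫ fst _ _ := by
    rw [whiskerLeft_fst_assoc]
    exact (whiskerRight_fst f _).symm
  obtain ⟨t, h, ht⟩ := exists_isIso_overStage_of_isIso S B (fst P₁ ((baseDiagram S).obj s) ≫ f) θ hθ hg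
  refine ⟨t, ?_⟩
  rwa [resStage_fst_comp, overStage_fst_comp] at ht

end LocApprox

end Literature.AlgebraicGeometry.Limits

end
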